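import Literature.AlgebraicGeometry.Frobenioids.Monoids
import Mathlib.GroupTheory.OrderOfElement
import Mathlib.Tactic.Ring
import HarnessLib

/-!
# [FrdI] §0: the perfection `M^pf` as the uniquely divisible hull — a recognition lemma

Mochizuki, *The geometry of Frobenioids I: the general theory*, Kyushu J. Math. **62** (2008) 293–400, §0 p. 11
[cite: MochizukiFrdI2008, §0 p.11]: "`M^pf := lim_→ M` (the inductive system `N_{≥1}` ordered by divisibility,
transition maps multiplication by `n`) … `M^pf` is always perfect."

abc-iut cell, layer L1, row M13-c3 piece P2 (seat abc-iut-w5-d246): a GENERIC recognition lemma for the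
perfection (abc-iut's `Frobenioids.Perfection M`, §0): if `f : M → B` is a homomorphism into a commutative group
`B` such that (a) `B` is torsion-free, (b) every `f(x)` has `n`-th roots in `B` for all `n ≥ 1`, (c) `f x = f y`
only if `x^N = y^N` for some `N ≥ 1`, (d) every `b ∈ B` has some power `b^N`, `N ≥ 1`, in the image of `f`, then
`M^pf ≅ B` canonically (`x^{1/n} ↦ (f x)^{1/n}`): `nonempty_perfection_mulEquiv_of_divisibleHull`.  Used to identify
the rational functions `O^×((A, n)^birat)` of `C^ℚ = C^pf` ([FrdII] Thm. 3.6 (i)) with `(Φ^fld)^pf`.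
Proof-only, classical monoid algebra; nothing here bears on [IUTchIII] Cor. 3.12.
-/

namespace Literature.AlgebraicGeometry.Frobenioids

namespace Perfection

universe u v

variable {M : Type u} [CommMonoid M] {B : Type v} [CommGroup B]

/-- Uniqueness of roots in a torsion-free commutative group. [folklore] -/
private theorem torsionFree_root_unique (htf : ∀ (b : B) (N : ℕ+), b ^ (N : ℕ) = 1 → b = 1) {b b' : B} {n : ℕ+}
    (h : b ^ (n : ℕ) = b' ^ (n : ℕ)) : b = b' := by
  have : (b / b') ^ (n : ℕ) = 1 := by rw [div_pow, h, div_self']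
  exact div_eq_one.mp (htf _ n this)

/-- **`M^pf` is the uniquely divisible hull** ([FrdI] §0 p. 11): for `f : M →* B` into a torsion-free commutative
group in which every `f(x)` has all roots, with `f x = f y ⇒ x^N = y^N` and every element of `B` having a power in
the image, there is a multiplicative bijection `M^pf ≃* B` sending `x^{1/n}` to the `n`-th root of `f x`.
[cite: MochizukiFrdI2008, §0 p.11] -/
theorem nonempty_perfection_mulEquiv_of_divisibleHull (f : M →* B)
    (htf : ∀ (b : B) (N : ℕ+), b ^ (N : ℕ) = 1 → b = 1)
    (hroot : ∀ (x : M) (n : ℕ+), ∃ b : B, b ^ (n : ℕ) = f x)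
    (hker : ∀ x y : M, f x = f y → ∃ N : ℕ+, x ^ (N : ℕ) = y ^ (N : ℕ))
    (hsurj : ∀ b : B, ∃ (N : ℕ+) (x : M), b ^ (N : ℕ) = f x) :
    Nonempty (Frobenioids.Perfection M ≃* B) := by
  classical
  -- the root function on pairs and its invariance under the defining relation
  let g : M × ℕ+ → B := fun x => (hroot x.1 x.2).choose
  have hg : ∀ x : M × ℕ+, g x ^ (x.2 : ℕ) = f x.1 := fun x => (hroot x.1 x.2).choose_spec
  have hginv : ∀ x y : M × ℕ+, Frobenioids.PerfectionRel M x y → g x = g y := by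
    rintro ⟨x, n⟩ ⟨y, m⟩ ⟨N, hN⟩
    dsimp only at hN
    have hx : g (x, n) ^ (n : ℕ) = f x := hg (x, n)
    have hy : g (y, m) ^ (m : ℕ) = f y := hg (y, m)
    apply torsionFree_root_unique htf (n := n * m * N)
    have e1 : g (x, n) ^ ((n * m * N : ℕ+) : ℕ) = f (x ^ ((N : ℕ) * m)) := by
      rw [PNat.mul_coe, PNat.mul_coe, mul_assoc, pow_mul, hx, ← map_pow, mul_comm]
    have e2 : g (y, m) ^ ((n * m * N : ℕ+) : ℕ) = f (y ^ ((N : ℕ) * n)) := by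
      rw [PNat.mul_coe, PNat.mul_coe, show (n : ℕ) * m * N = m * (N * n) by ring, pow_mul, hy, ← map_pow]
    rw [e1, e2, hN]
  let G : Frobenioids.Perfection M → B := Quotient.lift g hginv
  have hG : ∀ (x : M) (n : ℕ+), G (Frobenioids.Perfection.mk x n) = g (x, n) := fun _ _ => rfl
  have hGpow : ∀ (x : M) (n : ℕ+), G (Frobenioids.Perfection.mk x n) ^ (n : ℕ) = f x := fun x n => hg (x, n)
  -- multiplicativity
  have hmul : ∀ a b, G (a * b) = G a * G b := by
    intro a b
    obtain ⟨⟨x, n⟩, rfl⟩ := Frobenioids.Perfection.mk_surjective a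
    obtain ⟨⟨y, m⟩, rfl⟩ := Frobenioids.Perfection.mk_surjective b
    change G (Frobenioids.Perfection.mk x n * Frobenioids.Perfection.mk y m) =
      G (Frobenioids.Perfection.mk x n) * G (Frobenioids.Perfection.mk y m)
    rw [Frobenioids.Perfection.mk_mul_mk]
    apply torsionFree_root_unique htf (n := n * m)
    rw [hGpow, mul_pow, PNat.mul_coe, pow_mul, hGpow, mul_comm (n : ℕ), pow_mul, hGpow, map_mul, map_pow, map_pow]
  let Ghom : Frobenioids.Perfection M →* B :=
    { toFun := G
      map_one' := by
        apply torsionFree_root_unique htf (n := 1)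
        rw [Frobenioids.Perfection.one_def, hGpow, map_one, one_pow]
      map_mul' := hmul }
  refine ⟨MulEquiv.ofBijective Ghom ⟨?_, ?_⟩⟩
  · intro a b hab
    obtain ⟨⟨x, n⟩, rfl⟩ := Frobenioids.Perfection.mk_surjective a
    obtain ⟨⟨y, m⟩, rfl⟩ := Frobenioids.Perfection.mk_surjective b
    change G (Frobenioids.Perfection.mk x n) = G (Frobenioids.Perfection.mk y m) at hab
    have hxy : f (x ^ (m : ℕ)) = f (y ^ (n : ℕ)) := by
      rw [map_pow, map_pow, ← hGpow x n, ← hGpow y m, ← pow_mul, ← pow_mul, mul_comm, hab]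
    obtain ⟨N, hN⟩ := hker _ _ hxy
    refine Frobenioids.Perfection.mk_eq_mk_iff.mpr ⟨N, ?_⟩
    rw [mul_comm, pow_mul, mul_comm, pow_mul, hN]
  · intro b
    obtain ⟨N, x, hx⟩ := hsurj b
    refine ⟨Frobenioids.Perfection.mk x N, torsionFree_root_unique htf (n := N) ?_⟩
    change G (Frobenioids.Perfection.mk x N) ^ (N : ℕ) = b ^ (N : ℕ)
    rw [hGpow, hx]

end Perfection

end Literature.AlgebraicGeometry.Frobenioids
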